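import Mathlib
import HarnessLib
import Summits.PneNP.PneNP.Theorems.RamseyUncertifiablePaleySosRungShellLevels

/-!
# The filled-matrix shell, part 2: the per-block quadratic forms (crux `PaleySosRung`, line
`weil-patch-transfer`, stub `stub_filledShell`)

For a fixed binomial-basis index `s` (`= |T|`, `T ⊆ L ∩ R`) the constant part of the level-`t`
filled matrix contributes, on the functions `Z_a = Σ_{L ⊇ T, |L| = a + s} x_L`, the quadratic form
with coefficients

  `β_s(a,b) = Σ_{d=0}^{s} (-1)^d C(s,d) · κ_{a+b+s+d} α^{a+b+s+d} / 2^{(a+d)(b+d)}`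

(offsets `a = |L| - s`, `b = |R| - s`; `κ_k = 2^{C(k,2)} 8^{k²}`). This file proves, for offsets
ranging over an arbitrary finite set `A` with `a + s ≤ t`, and for `α` small enough
(`|A| · 2^t κ_{2t} 2^{t²} · α ≤ 1/7`):

  `(4/7) Σ_a D_s(a) Z_a² ≤ Σ_{a,b} β_s(a,b) Z_a Z_b`,  `D_s(a) = κ_{2a+s} α^{2a+s} / 2^{a²}`

(`block_form_lower`): the leading terms (`d = 0`) are dominated by their diagonal through
`κ_{a+b+s}² 2^{a²+b²} 8^{2|a-b|} ≤ κ_{2a+s} κ_{2b+s} 2^{2ab}` (`aux_shellLevels`) and the row-sum bound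
`Σ_{b ≠ a} 8^{-|a-b|} ≤ 2/7`; the lower-order terms (`d ≥ 1`) carry an extra factor `α`. It also
proves the `s = 0` correction `(Σ_a κ_a α^a Z_a)² ≤ (1/63) Σ_a D_0(a) Z_a²` (`sq_sum_level_le`).
Generic tools: a scaled diagonal-dominance bound and a perturbation bound for finite quadratic
forms (`quadForm_lower_of_dominance`, `abs_quadForm_le_of_small`). No graphs appear here.
-/

set_option linter.dupNamespace false -- `Summit.PneNP.PneNP.…`: summit = sub-problem (D-0017)

namespace Summit.PneNP.PneNP.Theorems.PaleySosRungWeilPatch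

open Finset

-- The level weight `κ_k = 2^{C(k,2)} · 8^{k²}` (local notation, as in part 1).
local notation3 "κ[" k "]" => ((2 : ℝ) ^ (Nat.choose k 2) * (8 : ℝ) ^ (k ^ 2))

/-! ### Two generic quadratic-form estimates -/

/-- **Scaled diagonal dominance.** If `|M_{ij}| ≤ ρ_{ij} √D_i √D_j` off the diagonal with symmetric
nonnegative `ρ` of row sums `≤ θ`, and `D_i ≤ M_{ii}`, then `Σ M_{ij} Y_i Y_j ≥ (1-θ) Σ D_i Y_i²`. -/
theorem quadForm_lower_of_dominance {ι : Type*} [DecidableEq ι] (S : Finset ι)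
    (M ρ : ι → ι → ℝ) (D Y : ι → ℝ) (θ : ℝ)
    (hρsymm : ∀ i ∈ S, ∀ j ∈ S, ρ i j = ρ j i) (hρ0 : ∀ i ∈ S, ∀ j ∈ S, 0 ≤ ρ i j)
    (hrow : ∀ i ∈ S, ∑ j ∈ S, (if j = i then 0 else ρ i j) ≤ θ)
    (hoff : ∀ i ∈ S, ∀ j ∈ S, i ≠ j → |M i j| ≤ ρ i j * Real.sqrt (D i) * Real.sqrt (D j))
    (hdiag : ∀ i ∈ S, D i ≤ M i i) (hD : ∀ i ∈ S, 0 ≤ D i) :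
    (1 - θ) * ∑ i ∈ S, D i * Y i ^ 2 ≤ ∑ i ∈ S, ∑ j ∈ S, M i j * Y i * Y j := by
  -- termwise lower bound
  have hterm : ∀ i ∈ S, ∀ j ∈ S,
      (if j = i then D i * Y i ^ 2 else -(ρ i j * (D i * Y i ^ 2 + D j * Y j ^ 2) / 2)) ≤
        M i j * Y i * Y j := by
    intro i hi j hj
    split_ifs with h
    · rw [h]
      nlinarith [mul_nonneg (sub_nonneg.2 (hdiag i hi)) (sq_nonneg (Y i))]
    · have hij : i ≠ j := fun h' => h h'.symm
      have hb := hoff i hi j hj hij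
      have hDi := hD i hi
      have hDj := hD j hj
      have hρij := hρ0 i hi j hj
      -- |M Y Y| ≤ ρ √Di|Yi| √Dj|Yj| ≤ ρ (Di Yi² + Dj Yj²)/2
      have h1 : |M i j * Y i * Y j| ≤
          ρ i j * ((Real.sqrt (D i) * |Y i|) * (Real.sqrt (D j) * |Y j|)) := by
        rw [abs_mul, abs_mul]
        calc |M i j| * |Y i| * |Y j|
            ≤ ρ i j * Real.sqrt (D i) * Real.sqrt (D j) * |Y i| * |Y j| := by gcongr
          _ = _ := by ring
      have h2 : 2 * (Real.sqrt (D i) * |Y i|) * (Real.sqrt (D j) * |Y j|) ≤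
          D i * Y i ^ 2 + D j * Y j ^ 2 := by
        have := two_mul_le_add_sq (Real.sqrt (D i) * |Y i|) (Real.sqrt (D j) * |Y j|)
        rwa [mul_pow, mul_pow, sq_abs, sq_abs, Real.sq_sqrt hDi, Real.sq_sqrt hDj] at this
      have h3 := neg_abs_le (M i j * Y i * Y j)
      have h4 : ρ i j * ((Real.sqrt (D i) * |Y i|) * (Real.sqrt (D j) * |Y j|)) ≤
          ρ i j * ((D i * Y i ^ 2 + D j * Y j ^ 2) / 2) :=
        mul_le_mul_of_nonneg_left (by linarith) hρij
      linarith
  have hsum := Finset.sum_le_sum fun i hi => Finset.sum_le_sum fun j hj => hterm i hi j hj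
  refine le_trans ?_ hsum
  -- evaluate the lower bound
  have hsplit : ∀ i ∈ S, ∑ j ∈ S,
      (if j = i then D i * Y i ^ 2 else -(ρ i j * (D i * Y i ^ 2 + D j * Y j ^ 2) / 2)) =
      D i * Y i ^ 2 - (1 / 2) * (D i * Y i ^ 2 * ∑ j ∈ S, (if j = i then 0 else ρ i j)) -
        (1 / 2) * ∑ j ∈ S, (if j = i then 0 else ρ i j * (D j * Y j ^ 2)) := by
    intro i hi
    have hpt : ∀ j ∈ S,
        (if j = i then D i * Y i ^ 2 else -(ρ i j * (D i * Y i ^ 2 + D j * Y j ^ 2) / 2)) =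
        (if j = i then D i * Y i ^ 2 else 0) +
          (-(1 / 2 : ℝ)) * (D i * Y i ^ 2 * (if j = i then 0 else ρ i j)) +
          (-(1 / 2 : ℝ)) * (if j = i then 0 else ρ i j * (D j * Y j ^ 2)) := by
      intro j _
      split_ifs <;> ring
    rw [Finset.sum_congr rfl hpt, Finset.sum_add_distrib, Finset.sum_add_distrib,
      Finset.sum_ite_eq' S i, if_pos hi, ← Finset.mul_sum, ← Finset.mul_sum, ← Finset.mul_sum]
    ring
  rw [Finset.sum_congr rfl hsplit, Finset.sum_sub_distrib, Finset.sum_sub_distrib]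
  -- the two halves of the off-diagonal sum are equal by symmetry
  have hsymm : ∑ i ∈ S, ∑ j ∈ S, (if j = i then 0 else ρ i j * (D j * Y j ^ 2)) =
      ∑ i ∈ S, D i * Y i ^ 2 * ∑ j ∈ S, (if j = i then 0 else ρ i j) := by
    rw [Finset.sum_comm]
    refine Finset.sum_congr rfl fun j hj => ?_
    rw [Finset.mul_sum]
    refine Finset.sum_congr rfl fun i hi => ?_
    by_cases h : i = j
    · subst h; simp
    · rw [if_neg (Ne.symm h), if_neg h, hρsymm i hi j hj]; ring
  rw [← Finset.mul_sum, ← Finset.mul_sum, hsymm]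
  have hbound : ∑ i ∈ S, D i * Y i ^ 2 * ∑ j ∈ S, (if j = i then 0 else ρ i j) ≤
      θ * ∑ i ∈ S, D i * Y i ^ 2 := by
    rw [Finset.mul_sum]
    refine Finset.sum_le_sum fun i hi => ?_
    have h1 := hrow i hi
    have h2 : 0 ≤ D i * Y i ^ 2 := mul_nonneg (hD i hi) (sq_nonneg _)
    nlinarith
  nlinarith

/-- **Perturbation.** If `|R_{ij}| ≤ ε √D_i √D_j` then `|Σ R_{ij} Y_i Y_j| ≤ ε |S| Σ D_i Y_i²`. -/
theorem abs_quadForm_le_of_small {ι : Type*} (S : Finset ι) (R : ι → ι → ℝ) (D Y : ι → ℝ)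
    (ε : ℝ) (hε : 0 ≤ ε) (hD : ∀ i ∈ S, 0 ≤ D i)
    (hR : ∀ i ∈ S, ∀ j ∈ S, |R i j| ≤ ε * Real.sqrt (D i) * Real.sqrt (D j)) :
    |∑ i ∈ S, ∑ j ∈ S, R i j * Y i * Y j| ≤ ε * S.card * ∑ i ∈ S, D i * Y i ^ 2 := by
  set w : ι → ℝ := fun i => Real.sqrt (D i) * |Y i| with hw
  have hw2 : ∀ i ∈ S, w i ^ 2 = D i * Y i ^ 2 := by
    intro i hi
    simp only [hw, mul_pow, sq_abs, Real.sq_sqrt (hD i hi)]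
  calc |∑ i ∈ S, ∑ j ∈ S, R i j * Y i * Y j|
      ≤ ∑ i ∈ S, |∑ j ∈ S, R i j * Y i * Y j| := Finset.abs_sum_le_sum_abs _ _
    _ ≤ ∑ i ∈ S, ∑ j ∈ S, |R i j * Y i * Y j| :=
        Finset.sum_le_sum fun i _ => Finset.abs_sum_le_sum_abs _ _
    _ ≤ ∑ i ∈ S, ∑ j ∈ S, ε * (w i * w j) := by
        refine Finset.sum_le_sum fun i hi => Finset.sum_le_sum fun j hj => ?_
        rw [abs_mul, abs_mul]
        calc |R i j| * |Y i| * |Y j| ≤ ε * Real.sqrt (D i) * Real.sqrt (D j) * |Y i| * |Y j| := by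
              gcongr
              exact hR i hi j hj
          _ = ε * (w i * w j) := by simp only [hw]; ring
    _ = ε * (∑ i ∈ S, w i) ^ 2 := by
        rw [sq, Finset.sum_mul_sum, Finset.mul_sum]
        refine Finset.sum_congr rfl fun i _ => ?_
        rw [Finset.mul_sum]
    _ ≤ ε * (S.card * ∑ i ∈ S, w i ^ 2) := by
        gcongr
        exact sq_sum_le_card_mul_sum_sq
    _ = ε * S.card * ∑ i ∈ S, D i * Y i ^ 2 := by
        rw [mul_assoc, Finset.sum_congr rfl hw2]

/-! ### The block coefficients -/

/-- The leading (`d = 0`) block coefficient at binomial index `s` and offsets `a, b`: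
`ℓ_s(a,b) = κ_{a+b+s} α^{a+b+s} / 2^{ab}`; its diagonal `D_s(a) = ℓ_s(a,a)`. Dominance:
`ℓ_s(a,b) · 8^{|a-b|} ≤ √(D_s(a) D_s(b))`. -/
theorem leading_le_sqrt (s a b : ℕ) {α : ℝ} (hα : 0 < α) :
    κ[a + b + s] * α ^ (a + b + s) / 2 ^ (a * b) ≤
      (8 : ℝ)⁻¹ ^ (a - b + (b - a)) *
        Real.sqrt (κ[2 * a + s] * α ^ (2 * a + s) / 2 ^ (a ^ 2)) *
        Real.sqrt (κ[2 * b + s] * α ^ (2 * b + s) / 2 ^ (b ^ 2)) := by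
  have hdom := aux_shellLevels a b s
  set n : ℕ := a - b + (b - a) with hn
  set L : ℝ := κ[a + b + s] * α ^ (a + b + s) / 2 ^ (a * b) with hL
  set Da : ℝ := κ[2 * a + s] * α ^ (2 * a + s) / 2 ^ (a ^ 2) with hDa
  set Db : ℝ := κ[2 * b + s] * α ^ (2 * b + s) / 2 ^ (b ^ 2) with hDb
  have hDa0 : 0 ≤ Da := by positivity
  -- compare squares: `(L · 8^n)² ≤ Da · Db` is `aux_shellLevels` times `α^{2(a+b+s)}`
  have hsq : (L * 8 ^ n) ^ 2 ≤ Da * Db := by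
    have eL : (L * 8 ^ n) ^ 2 =
        (κ[a + b + s] ^ 2 * 8 ^ (2 * n)) * α ^ (2 * (a + b + s)) / 2 ^ (2 * a * b) := by
      simp only [hL]
      field_simp
      ring
    have eD : Da * Db =
        (κ[2 * a + s] * κ[2 * b + s]) * α ^ (2 * (a + b + s)) / 2 ^ (a ^ 2 + b ^ 2) := by
      simp only [hDa, hDb]
      field_simp
      ring
    rw [eL, eD, div_le_div_iff₀ (by positivity) (by positivity)]
    calc κ[a + b + s] ^ 2 * 8 ^ (2 * n) * α ^ (2 * (a + b + s)) * 2 ^ (a ^ 2 + b ^ 2)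
        = (κ[a + b + s] ^ 2 * 2 ^ (a ^ 2 + b ^ 2) * 8 ^ (2 * n)) * α ^ (2 * (a + b + s)) := by ring
      _ ≤ (κ[2 * a + s] * κ[2 * b + s] * 2 ^ (2 * a * b)) * α ^ (2 * (a + b + s)) :=
          mul_le_mul_of_nonneg_right hdom (by positivity)
      _ = κ[2 * a + s] * κ[2 * b + s] * α ^ (2 * (a + b + s)) * 2 ^ (2 * a * b) := by ring
  have h1 : L * 8 ^ n ≤ Real.sqrt (Da * Db) := Real.le_sqrt_of_sq_le hsq
  calc L = (L * 8 ^ n) * (8 : ℝ)⁻¹ ^ n := by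
        rw [inv_pow, mul_assoc, mul_inv_cancel₀ (by positivity), mul_one]
    _ ≤ Real.sqrt (Da * Db) * (8 : ℝ)⁻¹ ^ n := by gcongr
    _ = _ := by rw [Real.sqrt_mul hDa0]; ring

/-- Row sums of the dominance kernel over any finite set of offsets: `Σ_{b ≠ a} 8^{-|a-b|} ≤ 2/7`
(restated with `if`). -/
theorem rowsum_inv_eight_le (a : ℕ) (A : Finset ℕ) :
    ∑ b ∈ A, (if b = a then 0 else (8 : ℝ)⁻¹ ^ (a - b + (b - a))) ≤ 2 / 7 := by
  have h := sum_inv_eight_pow_dist_le a A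
  rw [Finset.sum_filter] at h
  convert h using 2 with b
  by_cases hb : b = a <;> simp [hb]

/-- **Lower-order terms are `O(α)`.** For `k < s`, `a + s ≤ t`, `b + s ≤ t`, `0 < α ≤ 1`, the
`k`-th term of the binomial-basis coefficient is at most `κ_{2t} 2^{t²} · α · ℓ_s(a,b)`. -/
theorem lower_term_le (t s a b k : ℕ) {α : ℝ} (hα0 : 0 < α) (hα1 : α ≤ 1)
    (ha : a + s ≤ t) (hb : b + s ≤ t) (hk : k < s) :
    κ[a + b + 2 * s - k] * α ^ (a + b + 2 * s - k) / 2 ^ ((a + s - k) * (b + s - k)) ≤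
      (κ[2 * t] * 2 ^ (t ^ 2)) * α * (κ[a + b + s] * α ^ (a + b + s) / 2 ^ (a * b)) := by
  have hk1 : κ[a + b + 2 * s - k] ≤ κ[2 * t] := kap_le_kap (by omega)
  have hk2 : (1 : ℝ) ≤ κ[a + b + s] := one_le_kap _
  have hαpow : α ^ (a + b + 2 * s - k) ≤ α ^ (a + b + s + 1) :=
    pow_le_pow_of_le_one hα0.le hα1 (by omega)
  have h2ab : (2 : ℝ) ^ (a * b) ≤ 2 ^ (t ^ 2) := by
    apply pow_le_pow_right₀ (by norm_num)
    nlinarith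
  calc κ[a + b + 2 * s - k] * α ^ (a + b + 2 * s - k) / 2 ^ ((a + s - k) * (b + s - k))
      ≤ κ[a + b + 2 * s - k] * α ^ (a + b + 2 * s - k) := by
        apply div_le_self (by positivity)
        exact one_le_pow₀ (by norm_num)
    _ ≤ κ[2 * t] * α ^ (a + b + s + 1) := by gcongr
    _ = κ[2 * t] * α * (1 * α ^ (a + b + s) / 1) := by ring
    _ ≤ κ[2 * t] * α * ((2 ^ (t ^ 2) / 2 ^ (a * b)) * (κ[a + b + s] * α ^ (a + b + s)) / 1) := by
        gcongr
        · rw [le_div_iff₀ (by positivity), one_mul]; exact h2ab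
        · exact le_mul_of_one_le_left (by positivity) hk2
    _ = (κ[2 * t] * 2 ^ (t ^ 2)) * α * (κ[a + b + s] * α ^ (a + b + s) / 2 ^ (a * b)) := by ring

/-! ### The block estimate -/

/-- **The per-block lower bound.** For the binomial index `s`, offsets in a finite set `A` with
`a + s ≤ t`, and `0 < α ≤ 1` with `|A| · 2^s κ_{2t} 2^{t²} · α ≤ 1/7`:
`(4/7) Σ_a D_s(a) Z_a² ≤ Σ_{a,b} β_s(a,b) Z_a Z_b`, where
`β_s(a,b) = Σ_{k ≤ s} (-1)^{s-k} C(s,k) κ_{a+b+2s-k} α^{a+b+2s-k} / 2^{(a+s-k)(b+s-k)}` and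
`D_s(a) = κ_{2a+s} α^{2a+s} / 2^{a²}`. -/
theorem block_form_lower (t s : ℕ) (A : Finset ℕ) (hA : ∀ a ∈ A, a + s ≤ t) {α : ℝ}
    (hα0 : 0 < α) (hα1 : α ≤ 1)
    (hsmall : (A.card : ℝ) * (2 ^ s * κ[2 * t] * 2 ^ (t ^ 2)) * α ≤ 1 / 7) (Z : ℕ → ℝ) :
    (4 / 7) * ∑ a ∈ A, κ[2 * a + s] * α ^ (2 * a + s) / 2 ^ (a ^ 2) * Z a ^ 2 ≤
      ∑ a ∈ A, ∑ b ∈ A,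
        (∑ k ∈ Finset.range (s + 1), (-1 : ℝ) ^ (s - k) * (s.choose k : ℝ) *
            (κ[a + b + 2 * s - k] * α ^ (a + b + 2 * s - k) / 2 ^ ((a + s - k) * (b + s - k)))) *
          Z a * Z b := by
  classical
  -- leading terms, diagonal, lower-order terms
  set ℓ : ℕ → ℕ → ℝ := fun a b => κ[a + b + s] * α ^ (a + b + s) / 2 ^ (a * b) with hℓ
  set Dg : ℕ → ℝ := fun a => κ[2 * a + s] * α ^ (2 * a + s) / 2 ^ (a ^ 2) with hDg
  set r : ℕ → ℕ → ℝ := fun a b => ∑ k ∈ Finset.range s, (-1 : ℝ) ^ (s - k) * (s.choose k : ℝ) *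
      (κ[a + b + 2 * s - k] * α ^ (a + b + 2 * s - k) / 2 ^ ((a + s - k) * (b + s - k))) with hr
  set ε : ℝ := 2 ^ s * κ[2 * t] * 2 ^ (t ^ 2) * α with hε
  have hε0 : 0 ≤ ε := by positivity
  have hsplit : ∀ a b : ℕ,
      (∑ k ∈ Finset.range (s + 1), (-1 : ℝ) ^ (s - k) * (s.choose k : ℝ) *
        (κ[a + b + 2 * s - k] * α ^ (a + b + 2 * s - k) / 2 ^ ((a + s - k) * (b + s - k)))) =
        ℓ a b + r a b := by
    intro a b
    rw [Finset.sum_range_succ, add_comm]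
    congr 1
    simp only [hℓ, Nat.sub_self, pow_zero, Nat.choose_self, Nat.cast_one, one_mul,
      Nat.add_sub_cancel]
    rw [show a + b + 2 * s - s = a + b + s by omega]
  have hDℓ : ∀ a, Dg a = ℓ a a := by
    intro a
    simp only [hDg, hℓ]
    rw [show a + a + s = 2 * a + s by ring, show a * a = a ^ 2 by ring]
  have hDg0 : ∀ a, 0 ≤ Dg a := fun a => by simp only [hDg]; positivity
  have hℓ0 : ∀ a b, 0 ≤ ℓ a b := fun a b => by simp only [hℓ]; positivity
  have hℓdom : ∀ a b, ℓ a b ≤ (8 : ℝ)⁻¹ ^ (a - b + (b - a)) * Real.sqrt (Dg a) * Real.sqrt (Dg b) :=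
    fun a b => leading_le_sqrt s a b hα0
  -- (1) leading part by scaled diagonal dominance
  have hlead : (1 - 2 / 7) * ∑ a ∈ A, Dg a * Z a ^ 2 ≤ ∑ a ∈ A, ∑ b ∈ A, ℓ a b * Z a * Z b := by
    refine quadForm_lower_of_dominance A ℓ (fun a b => (8 : ℝ)⁻¹ ^ (a - b + (b - a))) Dg Z (2 / 7)
      (fun a _ b _ => by rw [add_comm]) (fun a _ b _ => by positivity)
      (fun a _ => rowsum_inv_eight_le a A) (fun a _ b _ _ => ?_) (fun a _ => (hDℓ a).le)
      (fun a _ => hDg0 a)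
    rw [abs_of_nonneg (hℓ0 a b)]
    exact hℓdom a b
  -- (2) lower-order part is small
  have hrle : ∀ a ∈ A, ∀ b ∈ A, |r a b| ≤ ε * Real.sqrt (Dg a) * Real.sqrt (Dg b) := by
    intro a ha b hb
    have hterm : ∀ k ∈ Finset.range s,
        |(-1 : ℝ) ^ (s - k) * (s.choose k : ℝ) *
          (κ[a + b + 2 * s - k] * α ^ (a + b + 2 * s - k) / 2 ^ ((a + s - k) * (b + s - k)))| ≤
          (s.choose k : ℝ) * ((κ[2 * t] * 2 ^ (t ^ 2)) * α * ℓ a b) := by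
      intro k hk
      rw [Finset.mem_range] at hk
      rw [abs_mul, abs_mul, abs_pow, abs_neg, abs_one, one_pow, one_mul, Nat.abs_cast,
        abs_of_nonneg (by positivity)]
      exact mul_le_mul_of_nonneg_left (lower_term_le t s a b k hα0 hα1 (hA a ha) (hA b hb) hk)
        (Nat.cast_nonneg _)
    calc |r a b| ≤ ∑ k ∈ Finset.range s, |(-1 : ℝ) ^ (s - k) * (s.choose k : ℝ) *
          (κ[a + b + 2 * s - k] * α ^ (a + b + 2 * s - k) / 2 ^ ((a + s - k) * (b + s - k)))| :=
          Finset.abs_sum_le_sum_abs _ _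
      _ ≤ ∑ k ∈ Finset.range s, (s.choose k : ℝ) * ((κ[2 * t] * 2 ^ (t ^ 2)) * α * ℓ a b) :=
          Finset.sum_le_sum hterm
      _ = (∑ k ∈ Finset.range s, (s.choose k : ℝ)) * ((κ[2 * t] * 2 ^ (t ^ 2)) * α * ℓ a b) := by
          rw [Finset.sum_mul]
      _ ≤ (2 : ℝ) ^ s * ((κ[2 * t] * 2 ^ (t ^ 2)) * α * ℓ a b) := by
          apply mul_le_mul_of_nonneg_right _ (by positivity)
          have h : ∑ k ∈ Finset.range s, (s.choose k : ℝ) ≤ ∑ k ∈ Finset.range (s + 1), (s.choose k : ℝ) :=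
            Finset.sum_le_sum_of_subset_of_nonneg (Finset.range_subset_range.2 (Nat.le_succ s))
              fun _ _ _ => Nat.cast_nonneg _
          refine h.trans (le_of_eq ?_)
          exact_mod_cast Nat.sum_range_choose s
      _ = ε * ℓ a b := by simp only [hε]; ring
      _ ≤ ε * ((8 : ℝ)⁻¹ ^ (a - b + (b - a)) * Real.sqrt (Dg a) * Real.sqrt (Dg b)) :=
          mul_le_mul_of_nonneg_left (hℓdom a b) hε0
      _ ≤ ε * (1 * Real.sqrt (Dg a) * Real.sqrt (Dg b)) := by
          gcongr
          exact pow_le_one₀ (by norm_num) (by norm_num)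
      _ = ε * Real.sqrt (Dg a) * Real.sqrt (Dg b) := by ring
  have hpert : |∑ a ∈ A, ∑ b ∈ A, r a b * Z a * Z b| ≤ ε * A.card * ∑ a ∈ A, Dg a * Z a ^ 2 :=
    abs_quadForm_le_of_small A r Dg Z ε hε0 (fun a _ => hDg0 a) hrle
  have hεA : ε * A.card ≤ 1 / 7 := by
    calc ε * A.card = (A.card : ℝ) * (2 ^ s * κ[2 * t] * 2 ^ (t ^ 2)) * α := by
          simp only [hε]; ring
      _ ≤ 1 / 7 := hsmall
  have hS0 : 0 ≤ ∑ a ∈ A, Dg a * Z a ^ 2 :=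
    Finset.sum_nonneg fun a _ => mul_nonneg (hDg0 a) (sq_nonneg _)
  -- (3) combine
  have hsum : ∑ a ∈ A, ∑ b ∈ A,
      (∑ k ∈ Finset.range (s + 1), (-1 : ℝ) ^ (s - k) * (s.choose k : ℝ) *
        (κ[a + b + 2 * s - k] * α ^ (a + b + 2 * s - k) / 2 ^ ((a + s - k) * (b + s - k)))) *
        Z a * Z b =
      (∑ a ∈ A, ∑ b ∈ A, ℓ a b * Z a * Z b) + ∑ a ∈ A, ∑ b ∈ A, r a b * Z a * Z b := by
    rw [← Finset.sum_add_distrib]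
    refine Finset.sum_congr rfl fun a _ => ?_
    rw [← Finset.sum_add_distrib]
    refine Finset.sum_congr rfl fun b _ => ?_
    rw [hsplit a b]
    ring
  have hDgsum : ∑ a ∈ A, κ[2 * a + s] * α ^ (2 * a + s) / 2 ^ (a ^ 2) * Z a ^ 2 =
      ∑ a ∈ A, Dg a * Z a ^ 2 := Finset.sum_congr rfl fun a _ => by simp only [hDg]
  rw [hsum, hDgsum]
  have habs := neg_abs_le (∑ a ∈ A, ∑ b ∈ A, r a b * Z a * Z b)
  nlinarith [mul_le_mul_of_nonneg_right hεA hS0]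

/-- **The `s = 0` correction.** For positive integers `a ∈ A`:
`(Σ_a κ_a α^a Z_a)² ≤ (1/63) · Σ_a (κ_{2a} α^{2a} / 2^{a²}) Z_a²`
(Cauchy–Schwarz with `κ_a² 2^{a²} / κ_{2a} = 64^{-a²}` and `Σ_{a ≥ 1} 64^{-a²} ≤ 1/63`). -/
theorem sq_sum_level_le (A : Finset ℕ) (hA : ∀ a ∈ A, 1 ≤ a) {α : ℝ} (hα0 : 0 < α) (Z : ℕ → ℝ) :
    (∑ a ∈ A, κ[a] * α ^ a * Z a) ^ 2 ≤
      (1 / 63) * ∑ a ∈ A, κ[2 * a] * α ^ (2 * a) / 2 ^ (a ^ 2) * Z a ^ 2 := by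
  set Dg : ℕ → ℝ := fun a => κ[2 * a] * α ^ (2 * a) / 2 ^ (a ^ 2) with hDg
  have hDpos : ∀ a, 0 < Dg a := fun a => by simp only [hDg]; positivity
  set f : ℕ → ℝ := fun a => κ[a] * α ^ a / Real.sqrt (Dg a) with hf
  set g : ℕ → ℝ := fun a => Real.sqrt (Dg a) * Z a with hg
  have hfg : ∀ a, f a * g a = κ[a] * α ^ a * Z a := by
    intro a
    have hs : Real.sqrt (Dg a) ≠ 0 := (Real.sqrt_pos.2 (hDpos a)).ne'
    simp only [hf, hg]
    field_simp
  have hf2 : ∀ a, f a ^ 2 = (64 : ℝ)⁻¹ ^ (a ^ 2) := by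
    intro a
    simp only [hf]
    rw [div_pow, Real.sq_sqrt (hDpos a).le]
    simp only [hDg]
    have hk := kap_sq_mul a
    have h64 : ((64 : ℝ)⁻¹) ^ (a ^ 2) = 1 / 8 ^ (2 * a ^ 2) := by
      rw [inv_pow, one_div, pow_mul, show (8 : ℝ) ^ 2 = 64 by norm_num]
    rw [h64, div_div_eq_mul_div, mul_pow, ← pow_mul, eq_div_iff (by positivity),
      div_mul_eq_mul_div, div_eq_iff (by positivity), ← hk]
    ring
  have hg2 : ∀ a, g a ^ 2 = Dg a * Z a ^ 2 := by
    intro a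
    simp only [hg]
    rw [mul_pow, Real.sq_sqrt (hDpos a).le]
  have hcs := Finset.sum_mul_sq_le_sq_mul_sq A f g
  rw [Finset.sum_congr rfl fun a _ => hfg a, Finset.sum_congr rfl fun a _ => hf2 a,
    Finset.sum_congr rfl fun a _ => hg2 a] at hcs
  have h63 := sum_inv_sixtyfour_pow_sq_le A hA
  have hS0 : 0 ≤ ∑ a ∈ A, Dg a * Z a ^ 2 :=
    Finset.sum_nonneg fun a _ => mul_nonneg (hDpos a).le (sq_nonneg _)
  have hDgsum : ∑ a ∈ A, κ[2 * a] * α ^ (2 * a) / 2 ^ (a ^ 2) * Z a ^ 2 = ∑ a ∈ A, Dg a * Z a ^ 2 :=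
    Finset.sum_congr rfl fun a _ => by simp only [hDg]
  rw [hDgsum]
  nlinarith [mul_le_mul_of_nonneg_right h63 hS0]

end Summit.PneNP.PneNP.Theorems.PaleySosRungWeilPatch

namespace Summit.PneNP.PneNP.Theorems.PaleySosRungWeilPatch

/-- Registered sub-goal `aux_shellBlock` of stub `stub_filledShell` (crux stmt-PneNP-9817): the
`s = 0` correction `sq_sum_level_le` with the level weights written out. -/
theorem aux_shellBlock : ∀ (A : Finset ℕ), (∀ a ∈ A, 1 ≤ a) → ∀ (α : ℝ), 0 < α → ∀ (Z : ℕ → ℝ),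
    (∑ a ∈ A, ((2 : ℝ) ^ (a.choose 2) * (8 : ℝ) ^ (a ^ 2)) * α ^ a * Z a) ^ 2 ≤
      (1 / 63) * ∑ a ∈ A, ((2 : ℝ) ^ ((2 * a).choose 2) * (8 : ℝ) ^ ((2 * a) ^ 2)) * α ^ (2 * a) /
        2 ^ (a ^ 2) * Z a ^ 2 :=
  fun A hA _ hα Z => sq_sum_level_le A hA hα Z

end Summit.PneNP.PneNP.Theorems.PaleySosRungWeilPatch
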